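import Mathlib.Analysis.Fourier.ZMod
import Mathlib.Analysis.Fourier.FourierTransform
import Mathlib.Analysis.SpecialFunctions.Integrals.Basic
import Mathlib.Analysis.InnerProductSpace.Calculus
import Mathlib.Analysis.SpecialFunctions.Trigonometric.Bounds
import Literature.Analysis.Fourier.DiscreteFractalUncertainty
import Literature.Analysis.Fourier.FractalUncertaintyPrinciple
import HarnessLib

/-!
# Dyatlov–Jin 2018, Proposition 4.8: the printed reduction to the Bourgain–Dyatlov FUP

S. Dyatlov, L. Jin, *Dolgopyat's method and the fractal uncertainty principle*, Analysis & PDE 11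
(2018) 1457–1485 (arXiv:1702.03619), §4.4. The discrete fractal uncertainty principle
`DyatlovJin2018_prop_4_8` (vendored in `DiscreteFractalUncertainty.lean`) is proved in print from
Proposition 4.7 ibid., which is "the following reformulation of [BD16]" = Bourgain–Dyatlov,
*Spectral gaps without the pressure condition*, Ann. of Math. 187 (2018), Theorem 4 — vendored as the
named fact `bourgainDyatlov2018_thm4` (`FractalUncertaintyPrinciple.lean`). This file formalizes the
printed proof of Proposition 4.8 (pp. 16–17 of the arXiv version) as the implication

  `bourgainDyatlov2018_thm4 → DyatlovJin2018_prop_4_8`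

(`DyatlovJin2018_prop_4_8_of_bourgainDyatlov2018_thm4`). The architecture follows the paper:

* fattening (`h = N⁻¹`, `X̃ = hX + [-h, h]`, `Ỹ_N = Y + [-1, 1]` with scaled Lebesgue measure;
  Lemma 4.3 + the fattening lemma of §2 there): a discretely `δ`-regular `X ⊂ ℤ_N` fattens to a
  `δ`-regular set in the sense of Bourgain–Dyatlov Definition 1.1 (`isRegularSet_fatten`);
* the test function `f̂(ξ) = ∑_{ℓ ∈ Y} u(ℓ) χ(ξ - ℓ)`: we take `χ = 𝟙_{[-1/8, 1/8]}` (the paper takes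
  a smooth bump with `𝓕⁻¹χ ≠ 0` on `[0, 1]`; only `|𝓕⁻¹χ| ≥ c` on `[-1, 1]` is used, and for our
  `χ` one has `Re 𝓕⁻¹χ(x) = ∫_{-1/8}^{1/8} cos(2πηx) dη ≥ 1/8` for `|x| ≤ 1`);
* `𝓕⁻¹ f̂ = φ · P` with `P(x) = ∑_ℓ u(ℓ) e^{2πiℓx}` a trigonometric polynomial whose values at
  `j/N` are the (conjugated) discrete Fourier coefficients;
* the local Sobolev step "`(|f|²)' = 2 Re (f̄ f')`" on the cells `I_j`, `j ∈ X`, and Parseval on a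
  unit interval for `P'` (replacing the paper's `‖f'‖ ≤ 10 N ‖f‖`, so no Plancherel on `ℝ` is
  needed); the Cauchy–Schwarz step is replaced by the weighted AM–GM `2|P||P'| ≤ λ|P|² + λ⁻¹|P'|²`
  with `λ = N^{1+β₀}`.

Outcome: `β = β₀ / 2` exactly as printed. No new named facts are introduced; the discharge
`DyatlovJin2018_prop_4_8_holds` is then one line once `bourgainDyatlov2018_thm4` is discharged.
Helper lemmas live in the sub-namespace `Literature.Analysis.Fourier.DyatlovJin2018`; the main
theorem is `Literature.Analysis.Fourier.DyatlovJin2018_prop_4_8_of_bourgainDyatlov2018_thm4`.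

The transfer is carried out at a FIXED exponent `δ`
(`DyatlovJin2018_prop_4_8_at_of_fup_at`: the conclusion of Prop. 4.8 at `δ`, for every constant
`C_R`, from the conclusion of Bourgain–Dyatlov's Theorem 4 at the same `δ` for all constants `≥ 1`),
so that partial ranges of `δ` transfer as they are proved. Also proved here, unconditionally:
`DyatlovJin2018_prop_4_8_of_lt_half` — Prop. 4.8 in the regime `0 ≤ δ < 1/2` with the volume-bound
exponent `β = 1/2 - δ` ("Using the Lebesgue volume bound … and Hölder's inequality, it is easy to
obtain (1.2) with `β = max(0, 1/2 - δ)`", §1 p. 2 ibid.; in `ℤ_N`: `#X, #Y ≤ C_R N^δ` and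
`|𝓕_N u(j)|² ≤ N⁻¹ #Y ‖u‖²`). The regime `1/2 ≤ δ < 1` is exactly the content of
`bourgainDyatlov2018_thm4` (Bourgain–Dyatlov 2018, §3: Beurling–Malliavin multiplier theorem,
harmonic-measure estimates on slit strips, induction on scales).
-/

open MeasureTheory Set Finset
open Complex (I)
open scoped Real FourierTransform ComplexConjugate

namespace Literature.Analysis.Fourier

namespace DyatlovJin2018

/-! ## Exponentials along the real line -/

/-- `d/dt e^{ct} = c e^{ct}` for real `t`. [folklore] -/
theorem hasDerivAt_cexp_const_mul_real (c : ℂ) (x : ℝ) :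
    HasDerivAt (fun t : ℝ => Complex.exp (c * t)) (c * Complex.exp (c * x)) x := by
  have h1 : HasDerivAt (fun t : ℝ => c * (t : ℂ)) c x := by
    simpa using ((hasDerivAt_id x).ofReal_comp).const_mul c
  convert h1.cexp using 1
  ring

/-- `∫_a^{a+1} e^{2πi k x} dx = [k = 0]` for an integer `k`. [folklore] -/
theorem integral_cexp_two_pi_int_mul (k : ℤ) (a : ℝ) :
    ∫ x in a..(a + 1), Complex.exp (2 * π * I * k * x) = if k = 0 then 1 else 0 := by
  split_ifs with hk
  · subst hk
    simp
  · have hc : (2 * π * I * k : ℂ) ≠ 0 := by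
      have h1 : (k : ℂ) ≠ 0 := by exact_mod_cast hk
      have h2 : (π : ℂ) ≠ 0 := by exact_mod_cast Real.pi_ne_zero
      simp [h1, h2, Complex.I_ne_zero]
    rw [integral_exp_mul_complex hc]
    have : Complex.exp (2 * π * I * k * ((a : ℂ) + 1)) = Complex.exp (2 * π * I * k * a) := by
      rw [show (2 * π * I * k * ((a : ℂ) + 1)) = 2 * π * I * k * a + k * (2 * π * I) by ring,
        Complex.exp_add, Complex.exp_int_mul_two_pi_mul_I, mul_one]
    push_cast
    rw [this, sub_self, zero_div]

/-- Conjugating `e^{2πi n x}` (`n, x` real) negates the exponent. [folklore] -/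
theorem conj_cexp_two_pi_mul (n x : ℝ) :
    conj (Complex.exp (2 * π * I * n * x)) = Complex.exp (-(2 * π * I * n * x)) := by
  rw [← Complex.exp_conj]
  congr 1
  simp only [map_mul, map_ofNat, Complex.conj_ofReal, Complex.conj_I]
  ring

/-- **Parseval on a unit interval** for a finite exponential sum with distinct natural frequencies:
`∫_a^{a+1} |∑ c_i e^{2πi n_i x}|² dx = ∑ |c_i|²`. [folklore] -/
theorem intervalIntegral_norm_sq_expSum {ι : Type*} (s : Finset ι) (n : ι → ℕ)
    (hn : Set.InjOn n s) (c : ι → ℂ) (a : ℝ) :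
    ∫ x in a..(a + 1), ‖∑ i ∈ s, c i * Complex.exp (2 * π * I * (n i) * x)‖ ^ 2 =
      ∑ i ∈ s, ‖c i‖ ^ 2 := by
  have hexp : ∀ x : ℝ, ((‖∑ i ∈ s, c i * Complex.exp (2 * π * I * (n i) * x)‖ ^ 2 : ℝ) : ℂ) =
      ∑ i ∈ s, ∑ j ∈ s, c i * conj (c j) *
        Complex.exp (2 * π * I * (((n i : ℤ) - (n j : ℤ) : ℤ) : ℂ) * x) := by
    intro x
    rw [← Complex.normSq_eq_norm_sq, ← Complex.mul_conj, map_sum, Finset.sum_mul_sum]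
    refine Finset.sum_congr rfl fun i _ => Finset.sum_congr rfl fun j _ => ?_
    rw [map_mul, show (n j : ℂ) = ((n j : ℝ) : ℂ) by push_cast; rfl, conj_cexp_two_pi_mul,
      mul_mul_mul_comm, ← Complex.exp_add]
    congr 1
    push_cast
    ring
  have hint : ∀ (i j : ι), IntervalIntegrable
      (fun x : ℝ => c i * conj (c j) *
        Complex.exp (2 * π * I * (((n i : ℤ) - (n j : ℤ) : ℤ) : ℂ) * x)) volume a (a + 1) := by
    intro i j
    exact (Continuous.intervalIntegrable (by fun_prop) _ _)
  apply Complex.ofReal_injective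
  rw [← intervalIntegral.integral_ofReal]
  simp_rw [hexp]
  rw [intervalIntegral.integral_finsetSum fun i _ =>
    (Continuous.intervalIntegrable (by fun_prop) _ _), Complex.ofReal_sum]
  refine Finset.sum_congr rfl fun i hi => ?_
  rw [intervalIntegral.integral_finsetSum fun j _ => hint i j, Finset.sum_eq_single i]
  · rw [intervalIntegral.integral_const_mul, integral_cexp_two_pi_int_mul, if_pos (sub_self _),
      mul_one, Complex.mul_conj, Complex.normSq_eq_norm_sq]
  · intro j hj hji
    rw [intervalIntegral.integral_const_mul, integral_cexp_two_pi_int_mul, if_neg, mul_zero]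
    have : n j ≠ n i := fun h => hji (hn hj hi h)
    omega
  · exact fun h => (h hi).elim

/-! ## The local Sobolev step -/

/-- The local Sobolev inequality behind "(|f|²)' = 2 Re (f̄ f')": for a `C¹` function `Q` on
`[a, b] ∋ t₀` and any `λ > 0`,
`(b - a) |Q(t₀)|² ≤ ∫_a^b |Q|² + (b - a) (λ ∫_a^b |Q|² + λ⁻¹ ∫_a^b |Q'|²)`.
[cite: DyatlovJin2018, proof of Prop. 4.8] -/
theorem norm_sq_le_intervalIntegral_of_hasDerivAt {Q Q' : ℝ → ℂ} (hQ : ∀ t, HasDerivAt Q (Q' t) t)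
    (hQ'c : Continuous Q') {a b t₀ lam : ℝ} (hab : a ≤ b) (ht₀ : t₀ ∈ Icc a b) (hlam : 0 < lam) :
    (b - a) * ‖Q t₀‖ ^ 2 ≤ (∫ t in a..b, ‖Q t‖ ^ 2) +
      (b - a) * (lam * (∫ t in a..b, ‖Q t‖ ^ 2) + lam⁻¹ * ∫ t in a..b, ‖Q' t‖ ^ 2) := by
  have hQc : Continuous Q := continuous_iff_continuousAt.2 fun t => (hQ t).continuousAt
  -- derivative of the squared norm
  have hD : ∀ t, HasDerivAt (fun s => ‖Q s‖ ^ 2) (2 * @inner ℝ ℂ _ (Q t) (Q' t)) t :=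
    fun t => (hQ t).norm_sq
  have hDc : Continuous fun t => 2 * @inner ℝ ℂ _ (Q t) (Q' t) := by fun_prop
  set D : ℝ := ∫ t in a..b, (lam * ‖Q t‖ ^ 2 + lam⁻¹ * ‖Q' t‖ ^ 2) with hDdef
  -- pointwise bound on the derivative of |Q|²
  have hptw : ∀ t, |2 * @inner ℝ ℂ _ (Q t) (Q' t)| ≤ lam * ‖Q t‖ ^ 2 + lam⁻¹ * ‖Q' t‖ ^ 2 := by
    intro t
    have h1 : |2 * @inner ℝ ℂ _ (Q t) (Q' t)| ≤ 2 * ‖Q t‖ * ‖Q' t‖ := by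
      rw [abs_mul, abs_two, mul_assoc]
      exact mul_le_mul_of_nonneg_left (abs_real_inner_le_norm _ _) (by norm_num)
    have h2 : 2 * ‖Q t‖ * ‖Q' t‖ ≤ lam * ‖Q t‖ ^ 2 + lam⁻¹ * ‖Q' t‖ ^ 2 := by
      rw [← sub_nonneg]
      have : lam * ‖Q t‖ ^ 2 + lam⁻¹ * ‖Q' t‖ ^ 2 - 2 * ‖Q t‖ * ‖Q' t‖ =
          lam⁻¹ * (lam * ‖Q t‖ - ‖Q' t‖) ^ 2 := by
        field_simp
        ring
      rw [this]
      positivity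
    exact h1.trans h2
  -- for every t ∈ [a,b]: |Q t₀|² ≤ |Q t|² + D
  have hkey : ∀ t ∈ Icc a b, ‖Q t₀‖ ^ 2 ≤ ‖Q t‖ ^ 2 + D := by
    intro t ht
    have hftc : ∫ s in t..t₀, 2 * @inner ℝ ℂ _ (Q s) (Q' s) = ‖Q t₀‖ ^ 2 - ‖Q t‖ ^ 2 :=
      intervalIntegral.integral_eq_sub_of_hasDerivAt (fun s _ => hD s)
        (hDc.intervalIntegrable _ _)
    have hmono : ∀ c d, a ≤ c → c ≤ d → d ≤ b →
        |∫ s in c..d, 2 * @inner ℝ ℂ _ (Q s) (Q' s)| ≤ D := by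
      intro c d hac hcd hdb
      calc |∫ s in c..d, 2 * @inner ℝ ℂ _ (Q s) (Q' s)|
          ≤ ∫ s in c..d, |2 * @inner ℝ ℂ _ (Q s) (Q' s)| :=
            intervalIntegral.abs_integral_le_integral_abs hcd
        _ ≤ ∫ s in a..b, |2 * @inner ℝ ℂ _ (Q s) (Q' s)| := by
            apply intervalIntegral.integral_mono_interval hac hcd hdb
            · exact Filter.Eventually.of_forall fun _ => abs_nonneg _
            · exact (hDc.abs).intervalIntegrable _ _
        _ ≤ D := by
            apply intervalIntegral.integral_mono_on hab ((hDc.abs).intervalIntegrable _ _)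
              (Continuous.intervalIntegrable (by fun_prop) _ _)
            exact fun s _ => hptw s
    have hbound : |∫ s in t..t₀, 2 * @inner ℝ ℂ _ (Q s) (Q' s)| ≤ D := by
      rcases le_total t t₀ with h | h
      · exact hmono t t₀ ht.1 h ht₀.2
      · rw [intervalIntegral.integral_symm, abs_neg]
        exact hmono t₀ t ht₀.1 h ht.2
    have h2 := (abs_le.1 hbound).2
    rw [hftc] at h2
    linarith
  -- integrate hkey over [a,b]
  have hI : (∫ t in a..b, ‖Q t₀‖ ^ 2) ≤ ∫ t in a..b, (‖Q t‖ ^ 2 + D) :=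
    intervalIntegral.integral_mono_on hab (by simp) (Continuous.intervalIntegrable (by fun_prop) _ _)
      hkey
  rw [intervalIntegral.integral_const, smul_eq_mul, intervalIntegral.integral_add
    (Continuous.intervalIntegrable (by fun_prop) _ _) (by simp), intervalIntegral.integral_const,
    smul_eq_mul] at hI
  have hDsplit : D = lam * (∫ t in a..b, ‖Q t‖ ^ 2) + lam⁻¹ * ∫ t in a..b, ‖Q' t‖ ^ 2 := by
    rw [hDdef, intervalIntegral.integral_add (Continuous.intervalIntegrable (by fun_prop) _ _)
      (Continuous.intervalIntegrable (by fun_prop) _ _), intervalIntegral.integral_const_mul,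
      intervalIntegral.integral_const_mul]
  rw [← hDsplit]
  linarith

/-! ## Summing over the cells `I_j = [(j - 1/2)/N, (j + 1/2)/N]` -/

/-- For `X ⊆ {0, …, N-1}` and `F ≥ 0` continuous, the integrals of `F` over the cells
`[(j - 1/2)/N, (j + 1/2)/N]`, `j ∈ X`, add up to at most the integral over the unit interval
`[-1/(2N), 1 - 1/(2N)]`. [folklore] -/
theorem sum_cellIntegral_le {N : ℕ} (hN : 0 < N) {X : Finset ℕ} (hX : ∀ x ∈ X, x < N)
    {F : ℝ → ℝ} (hF : Continuous F) (hF0 : ∀ t, 0 ≤ F t) :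
    ∑ j ∈ X, ∫ t in (((j : ℝ) - 1 / 2) / N)..(((j : ℝ) + 1 / 2) / N), F t ≤
      ∫ t in ((-(1 / 2) : ℝ) / N)..((-(1 / 2) : ℝ) / N + 1), F t := by
  have hNr : (0 : ℝ) < N := by exact_mod_cast hN
  set a : ℕ → ℝ := fun k => ((k : ℝ) - 1 / 2) / N with ha
  have hcell : ∀ j : ℕ, ((j : ℝ) + 1 / 2) / N = a (j + 1) := by
    intro j; simp only [ha]; push_cast; ring
  have hsum := intervalIntegral.sum_integral_adjacent_intervals (f := F) (μ := volume) (a := a)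
    (n := N) fun k _ => hF.intervalIntegrable _ _
  have ha0 : a 0 = (-(1 / 2) : ℝ) / N := by simp only [ha]; push_cast; ring
  have haN : a N = (-(1 / 2) : ℝ) / N + 1 := by simp only [ha]; field_simp; ring
  rw [ha0, haN] at hsum
  rw [← hsum]
  calc ∑ j ∈ X, ∫ t in (((j : ℝ) - 1 / 2) / N)..(((j : ℝ) + 1 / 2) / N), F t
      = ∑ j ∈ X, ∫ t in (a j)..(a (j + 1)), F t := by
        refine Finset.sum_congr rfl fun j _ => ?_
        rw [hcell j]
    _ ≤ ∑ k ∈ Finset.range N, ∫ t in (a k)..(a (k + 1)), F t := by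
        apply Finset.sum_le_sum_of_subset_of_nonneg
        · intro x hx; exact Finset.mem_range.2 (hX x hx)
        · intro k _ _
          apply intervalIntegral.integral_nonneg _ fun t _ => hF0 t
          simp only [ha]; push_cast
          exact div_le_div_of_nonneg_right (by linarith) hNr.le

/-! ## Fattening: discrete regularity gives Bourgain–Dyatlov regularity -/

/-- A nonempty discretely `δ`-regular set has `C_R ≥ 1` (the unit interval `[x₀, x₀ + 1]` at a point
`x₀ ∈ X` already contains a point). [cite: DyatlovJin2018, Def. 4.2] -/
theorem _root_.Literature.Analysis.Fourier.IsDiscreteRegular.one_le {δ C_R : ℝ} {N : ℕ} {X : Finset ℕ}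
    (hX : IsDiscreteRegular δ C_R N X) (hne : X.Nonempty) : 1 ≤ C_R := by
  obtain ⟨x₀, hx₀⟩ := hne
  have h := hX.1 (x₀ : ℝ) 1 le_rfl
  rw [Real.one_rpow, mul_one] at h
  refine le_trans ?_ h
  have : 1 ≤ countInIcc X x₀ (x₀ + 1) := by
    unfold countInIcc
    exact Finset.card_pos.2 ⟨x₀, by simp [hx₀]⟩
  exact_mod_cast this

/-- **Fattening** (Dyatlov–Jin 2018, Lemma 4.3 together with the fattening lemma of §2, in the form
used in the proof of Prop. 4.8): if `X ⊂ ℤ_N` is nonempty and `δ`-regular with constant `C_R`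
(`0 ≤ δ ≤ 1`), then for every scale `s > 0` the fattened rescaled set
`X̃_s = ⋃_{x ∈ X} [(x-1)/s, (x+1)/s]`, carrying the measure `s^{1-δ} · Leb|_{X̃_s}`, is `δ`-regular
with constant `8 C_R` on scales `1/s` to `N/s` in the sense of Bourgain–Dyatlov, Definition 1.1
(`IsRegularSet`). (The paper states the constant `30 C_R²`.) [cite: DyatlovJin2018, proof of Prop. 4.8] -/
theorem isRegularSet_fatten {δ C_R : ℝ} {N : ℕ} {X : Finset ℕ} (hδ0 : 0 ≤ δ) (hδ1 : δ ≤ 1)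
    (hX : IsDiscreteRegular δ C_R N X) (hne : X.Nonempty) {s : ℝ} (hs : 0 < s) :
    IsRegularSet (⋃ x ∈ X, Icc (((x : ℝ) - 1) / s) (((x : ℝ) + 1) / s)) δ (8 * C_R) (1 / s)
      (N / s) := by
  have hC : 1 ≤ C_R := hX.one_le hne
  set F : Set ℝ := ⋃ x ∈ X, Icc (((x : ℝ) - 1) / s) (((x : ℝ) + 1) / s) with hF
  have hFmeas : MeasurableSet F := Finset.measurableSet_biUnion _ fun x _ => measurableSet_Icc
  refine ⟨?_, isClosed_biUnion_finset fun x _ => isClosed_Icc,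
    ENNReal.ofReal (s ^ (1 - δ)) • volume.restrict F, ?_, ?_⟩
  · obtain ⟨x₀, hx₀⟩ := hne
    refine ⟨(x₀ : ℝ) / s, mem_iUnion₂.2 ⟨x₀, hx₀, ?_, ?_⟩⟩
    · exact div_le_div_of_nonneg_right (by linarith) hs.le
    · exact div_le_div_of_nonneg_right (by linarith) hs.le
  · simp [Measure.restrict_apply hFmeas.compl]
  intro a b hab hlo hhi
  have hsd : 0 < s ^ δ := Real.rpow_pos_of_pos hs δ
  have hs1 : s ^ (1 - δ) = s / s ^ δ := by rw [Real.rpow_sub hs, Real.rpow_one]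
  have hs1nn : 0 ≤ s ^ (1 - δ) := Real.rpow_nonneg hs.le _
  have hba : 0 < b - a := by linarith
  -- scaled quantities: `L = s (b - a) ∈ [1, N]`, centre `P = s (a + b) / 2`
  set L : ℝ := s * (b - a) with hL
  set P : ℝ := s * ((a + b) / 2) with hP
  have hsa : s * a = P - L / 2 := by rw [hP, hL]; ring
  have hsb : s * b = P + L / 2 := by rw [hP, hL]; ring
  have hL1 : 1 ≤ L := by
    have h := (div_le_iff₀ hs).1 hlo
    rw [hL]; linarith
  have hLN : L ≤ N := by
    have h := (le_div_iff₀ hs).1 hhi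
    rw [hL]; linarith
  have hLδ : (b - a) ^ δ = L ^ δ / s ^ δ := by
    rw [show b - a = L / s by rw [hL]; field_simp, Real.div_rpow (by positivity) hs.le]
  have hμ : (ENNReal.ofReal (s ^ (1 - δ)) • volume.restrict F) (Icc a b) =
      ENNReal.ofReal (s ^ (1 - δ)) * volume (Icc a b ∩ F) := by
    rw [Measure.smul_apply, Measure.restrict_apply measurableSet_Icc, smul_eq_mul]
  rw [hμ]
  constructor
  · ----------------------------------------------------------------- upper bound
    set X' := X.filter (fun x : ℕ => s * a - 1 ≤ (x : ℝ) ∧ (x : ℝ) ≤ s * b + 1) with hX'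
    have hsub : Icc a b ∩ F ⊆ ⋃ x ∈ X', Icc (((x : ℝ) - 1) / s) (((x : ℝ) + 1) / s) := by
      rintro t ⟨⟨hta, htb⟩, htF⟩
      obtain ⟨x, hx, hx1, hx2⟩ := mem_iUnion₂.1 htF
      refine mem_iUnion₂.2 ⟨x, ?_, hx1, hx2⟩
      rw [hX', Finset.mem_filter]
      refine ⟨hx, ?_, ?_⟩
      · have h := (le_div_iff₀ hs).1 (hta.trans hx2)
        linarith
      · have h := (div_le_iff₀ hs).1 (hx1.trans htb)
        linarith
    have hcount : (X'.card : ℝ) ≤ C_R * (L + 2) ^ δ := by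
      have h := hX.1 (s * a - 1) (L + 2) (by linarith)
      have h' : s * a - 1 + (L + 2) = s * b + 1 := by rw [hL]; ring
      rw [h'] at h
      exact h
    have hvol : volume (Icc a b ∩ F) ≤ ENNReal.ofReal (X'.card * (2 / s)) := by
      calc volume (Icc a b ∩ F)
          ≤ volume (⋃ x ∈ X', Icc (((x : ℝ) - 1) / s) (((x : ℝ) + 1) / s)) := measure_mono hsub
        _ ≤ ∑ x ∈ X', volume (Icc (((x : ℝ) - 1) / s) (((x : ℝ) + 1) / s)) :=
          measure_biUnion_finset_le _ _
        _ = ∑ x ∈ X', ENNReal.ofReal (2 / s) := by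
          refine Finset.sum_congr rfl fun x _ => ?_
          rw [Real.volume_Icc]
          congr 1
          field_simp
          ring
        _ = ENNReal.ofReal (X'.card * (2 / s)) := by
          rw [Finset.sum_const, nsmul_eq_mul, ENNReal.ofReal_mul (by positivity),
            ENNReal.ofReal_natCast]
    have h3 : (L + 2) ^ δ ≤ 3 * L ^ δ := by
      calc (L + 2) ^ δ ≤ (3 * L) ^ δ := Real.rpow_le_rpow (by positivity) (by linarith) hδ0
        _ = 3 ^ δ * L ^ δ := Real.mul_rpow (by norm_num) (by positivity)
        _ ≤ 3 * L ^ δ := by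
          gcongr
          calc (3 : ℝ) ^ δ ≤ 3 ^ (1 : ℝ) := Real.rpow_le_rpow_of_exponent_le (by norm_num) hδ1
            _ = 3 := Real.rpow_one 3
    have hLs : L ^ δ = s ^ δ * (b - a) ^ δ := by
      rw [hL, Real.mul_rpow hs.le hba.le]
    have hreal : s ^ (1 - δ) * (X'.card * (2 / s)) ≤ 8 * C_R * (b - a) ^ δ := by
      calc s ^ (1 - δ) * (X'.card * (2 / s)) = (s / s) * ((2 / s ^ δ) * X'.card) := by
            rw [hs1]; ring
        _ = (2 / s ^ δ) * X'.card := by rw [div_self hs.ne', one_mul]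
        _ ≤ (2 / s ^ δ) * (C_R * (3 * L ^ δ)) := by
            gcongr
            exact hcount.trans (by gcongr)
        _ = (s ^ δ / s ^ δ) * (6 * C_R * (b - a) ^ δ) := by rw [hLs]; ring
        _ = 6 * C_R * (b - a) ^ δ := by rw [div_self hsd.ne', one_mul]
        _ ≤ 8 * C_R * (b - a) ^ δ := by
            have : 0 ≤ C_R * (b - a) ^ δ := by positivity
            nlinarith
    calc ENNReal.ofReal (s ^ (1 - δ)) * volume (Icc a b ∩ F)
        ≤ ENNReal.ofReal (s ^ (1 - δ)) * ENNReal.ofReal (X'.card * (2 / s)) :=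
          mul_le_mul_right hvol _
      _ = ENNReal.ofReal (s ^ (1 - δ) * (X'.card * (2 / s))) := by
          rw [ENNReal.ofReal_mul hs1nn]
      _ ≤ ENNReal.ofReal (8 * C_R * (b - a) ^ δ) := ENNReal.ofReal_le_ofReal hreal
  · ----------------------------------------------------------------- lower bound
    intro hmid
    obtain ⟨x, hx, hxm1, hxm2⟩ := mem_iUnion₂.1 hmid
    have hx1 : (x : ℝ) - 1 ≤ P := by
      have h := (div_le_iff₀ hs).1 hxm1
      rw [hP]; linarith
    have hx2 : P ≤ x + 1 := by
      have h := (le_div_iff₀ hs).1 hxm2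
      rw [hP]; linarith
    by_cases hL4 : L < 4
    · -- short intervals: a piece of length ≥ 1/(2s) of the cell of `x` lies in `[a, b]`
      set lo : ℝ := max ((x : ℝ) - 1) (P - 1 / 2) with hlo'
      set hi : ℝ := min ((x : ℝ) + 1) (P + 1 / 2) with hhi'
      have hlen : lo + 1 / 2 ≤ hi := by
        have h1 : lo ≤ (x : ℝ) + 1 - 1 / 2 := max_le (by linarith) (by linarith)
        have h2 : lo ≤ P + 1 / 2 - 1 / 2 := max_le (by linarith) (by linarith)
        have h3 : lo + 1 / 2 ≤ min ((x : ℝ) + 1) (P + 1 / 2) := le_min (by linarith) (by linarith)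
        exact h3
      have hJsub : Icc (lo / s) (hi / s) ⊆ Icc a b ∩ F := by
        intro t ht
        refine ⟨⟨?_, ?_⟩, mem_iUnion₂.2 ⟨x, hx, ?_, ?_⟩⟩
        · have h1 : a ≤ (P - 1 / 2) / s := by
            rw [le_div_iff₀ hs, mul_comm, hsa]; linarith
          exact h1.trans ((div_le_div_of_nonneg_right (le_max_right _ _) hs.le).trans ht.1)
        · have h1 : (P + 1 / 2) / s ≤ b := by
            rw [div_le_iff₀ hs, mul_comm b, hsb]; linarith
          exact (ht.2.trans (div_le_div_of_nonneg_right (min_le_right _ _) hs.le)).trans h1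
        · exact (div_le_div_of_nonneg_right (le_max_left _ _) hs.le).trans ht.1
        · exact ht.2.trans (div_le_div_of_nonneg_right (min_le_left _ _) hs.le)
      have hL4δ : L ^ δ ≤ 4 :=
        calc L ^ δ ≤ 4 ^ δ := Real.rpow_le_rpow (by positivity) hL4.le hδ0
          _ ≤ 4 ^ (1 : ℝ) := Real.rpow_le_rpow_of_exponent_le (by norm_num) hδ1
          _ = 4 := Real.rpow_one 4
      have hreal : (8 * C_R)⁻¹ * (b - a) ^ δ ≤ s ^ (1 - δ) * (1 / (2 * s)) := by
        calc (8 * C_R)⁻¹ * (b - a) ^ δ = (8 * C_R)⁻¹ * (L ^ δ / s ^ δ) := by rw [hLδ]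
          _ ≤ (8 : ℝ)⁻¹ * (4 / s ^ δ) := by
              gcongr
              · linarith
          _ = s ^ (1 - δ) * (1 / (2 * s)) := by rw [hs1]; field_simp; ring
      calc ENNReal.ofReal ((8 * C_R)⁻¹ * (b - a) ^ δ)
          ≤ ENNReal.ofReal (s ^ (1 - δ) * (1 / (2 * s))) := ENNReal.ofReal_le_ofReal hreal
        _ = ENNReal.ofReal (s ^ (1 - δ)) * ENNReal.ofReal (1 / (2 * s)) := by
            rw [ENNReal.ofReal_mul hs1nn]
        _ ≤ ENNReal.ofReal (s ^ (1 - δ)) * volume (Icc (lo / s) (hi / s)) := by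
            refine mul_le_mul_right ?_ _
            rw [Real.volume_Icc]
            apply ENNReal.ofReal_le_ofReal
            rw [div_sub_div_same, show 1 / (2 * s) = (1 / 2) / s from (div_div 1 2 s).symm]
            exact div_le_div_of_nonneg_right (by linarith) hs.le
        _ ≤ ENNReal.ofReal (s ^ (1 - δ)) * volume (Icc a b ∩ F) :=
            mul_le_mul_right (measure_mono hJsub) _
    · -- long intervals: disjoint open cells around the points of `X` near `x`
      have hL4' : 4 ≤ L := not_lt.1 hL4
      set l : ℝ := L - 3 with hl
      have hl1 : 1 ≤ l := by rw [hl]; linarith [hL4']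
      have hlN : l ≤ N := by rw [hl]; linarith
      set Y' := X.filter (fun y : ℕ => (x : ℝ) - l / 2 ≤ (y : ℝ) ∧ (y : ℝ) ≤ (x : ℝ) + l / 2)
        with hY'
      have hcnt : C_R⁻¹ * l ^ δ ≤ Y'.card := hX.2 x hx l hl1 hlN
      have hUsub : (⋃ y ∈ Y', Ioo (((y : ℝ) - 1 / 2) / s) (((y : ℝ) + 1 / 2) / s)) ⊆
          Icc a b ∩ F := by
        intro t ht
        obtain ⟨y, hy, hty1, hty2⟩ := mem_iUnion₂.1 ht
        rw [hY', Finset.mem_filter] at hy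
        obtain ⟨hyX, hy1, hy2⟩ := hy
        refine ⟨⟨?_, ?_⟩, mem_iUnion₂.2 ⟨y, hyX, ?_, ?_⟩⟩
        · have h1 : a ≤ ((y : ℝ) - 1 / 2) / s := by
            rw [le_div_iff₀ hs, mul_comm, hsa]
            linarith
          exact h1.trans hty1.le
        · have h1 : ((y : ℝ) + 1 / 2) / s ≤ b := by
            rw [div_le_iff₀ hs, mul_comm b, hsb]
            linarith
          exact hty2.le.trans h1
        · exact (div_le_div_of_nonneg_right (by linarith) hs.le).trans hty1.le
        · exact hty2.le.trans (div_le_div_of_nonneg_right (by linarith) hs.le)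
      have hdisj : Set.PairwiseDisjoint (↑Y' : Set ℕ)
          (fun y : ℕ => Ioo (((y : ℝ) - 1 / 2) / s) (((y : ℝ) + 1 / 2) / s)) := by
        intro y _ y' _ hne
        refine Set.disjoint_left.2 fun t ht ht' => ?_
        have h1 := (div_lt_iff₀ hs).1 ht.1
        have h2 := (lt_div_iff₀ hs).1 ht.2
        have h3 := (div_lt_iff₀ hs).1 ht'.1
        have h4 := (lt_div_iff₀ hs).1 ht'.2
        rcases lt_or_gt_of_ne hne with hlt | hlt
        · have h5 : (y : ℝ) + 1 ≤ y' := by exact_mod_cast hlt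
          linarith
        · have h5 : (y' : ℝ) + 1 ≤ y := by exact_mod_cast hlt
          linarith
      have hvolU : volume (⋃ y ∈ Y', Ioo (((y : ℝ) - 1 / 2) / s) (((y : ℝ) + 1 / 2) / s)) =
          ENNReal.ofReal (Y'.card * (1 / s)) := by
        rw [measure_biUnion_finset hdisj fun y _ => measurableSet_Ioo]
        calc ∑ y ∈ Y', volume (Ioo (((y : ℝ) - 1 / 2) / s) (((y : ℝ) + 1 / 2) / s))
            = ∑ y ∈ Y', ENNReal.ofReal (1 / s) := by
              refine Finset.sum_congr rfl fun y _ => ?_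
              rw [Real.volume_Ioo]
              congr 1
              field_simp
              ring
          _ = ENNReal.ofReal (Y'.card * (1 / s)) := by
              rw [Finset.sum_const, nsmul_eq_mul, ENNReal.ofReal_mul (by positivity),
                ENNReal.ofReal_natCast]
      have hL4δ : L ^ δ ≤ 8 * l ^ δ :=
        calc L ^ δ ≤ (4 * l) ^ δ := Real.rpow_le_rpow (by positivity) (by rw [hl]; linarith [hL4']) hδ0
          _ = 4 ^ δ * l ^ δ := Real.mul_rpow (by norm_num) (by linarith)
          _ ≤ 4 * l ^ δ := by
              gcongr
              calc (4 : ℝ) ^ δ ≤ 4 ^ (1 : ℝ) := Real.rpow_le_rpow_of_exponent_le (by norm_num) hδ1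
                _ = 4 := Real.rpow_one 4
          _ ≤ 8 * l ^ δ := by
              have : 0 ≤ l ^ δ := Real.rpow_nonneg (by linarith) δ
              nlinarith
      have hC0 : 0 < C_R := by linarith
      have hreal : (8 * C_R)⁻¹ * (b - a) ^ δ ≤ s ^ (1 - δ) * (C_R⁻¹ * l ^ δ * (1 / s)) := by
        rw [hLδ, hs1]
        have h8 : (8 * C_R)⁻¹ * (L ^ δ / s ^ δ) ≤ (8 * C_R)⁻¹ * (8 * l ^ δ / s ^ δ) := by
          gcongr
        refine h8.trans (le_of_eq ?_)
        calc (8 * C_R)⁻¹ * (8 * l ^ δ / s ^ δ)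
            = (8 / 8) * (C_R⁻¹ * l ^ δ / s ^ δ) := by ring
          _ = (s / s) * (C_R⁻¹ * l ^ δ / s ^ δ) := by rw [div_self hs.ne', div_self (by norm_num)]
          _ = s / s ^ δ * (C_R⁻¹ * l ^ δ * (1 / s)) := by ring
      calc ENNReal.ofReal ((8 * C_R)⁻¹ * (b - a) ^ δ)
          ≤ ENNReal.ofReal (s ^ (1 - δ) * (C_R⁻¹ * l ^ δ * (1 / s))) :=
            ENNReal.ofReal_le_ofReal hreal
        _ ≤ ENNReal.ofReal (s ^ (1 - δ) * (Y'.card * (1 / s))) := by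
            apply ENNReal.ofReal_le_ofReal
            gcongr
        _ = ENNReal.ofReal (s ^ (1 - δ)) *
              volume (⋃ y ∈ Y', Ioo (((y : ℝ) - 1 / 2) / s) (((y : ℝ) + 1 / 2) / s)) := by
            rw [hvolU, ENNReal.ofReal_mul hs1nn]
        _ ≤ ENNReal.ofReal (s ^ (1 - δ)) * volume (Icc a b ∩ F) :=
            mul_le_mul_right (measure_mono hUsub) _

/-! ## Trigonometric polynomials and the discrete Fourier transform -/

/-- The discrete Fourier coefficient as a value of a trigonometric polynomial:
`conj (𝓕_N u)(j) = ∑_ℓ conj(u ℓ) e^{2πi ℓ (j/N)}` (Mathlib's unnormalised `ZMod.dft`,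
`𝓕 Φ k = ∑_j e^{-2πi jk/N} Φ j`). [folklore] -/
theorem conj_dft_eq_expSum {N : ℕ} [NeZero N] (u : ZMod N → ℂ) (j : ZMod N) :
    conj (ZMod.dft u j) = ∑ ℓ : ZMod N, conj (u ℓ) *
      Complex.exp (2 * π * I * (ℓ.val : ℕ) * (((j.val : ℝ) / N : ℝ) : ℂ)) := by
  rw [ZMod.dft_apply, map_sum]
  refine Finset.sum_congr rfl fun ℓ _ => ?_
  rw [smul_eq_mul, map_mul, mul_comm]
  congr 1
  rw [ZMod.stdAddChar_apply, AddChar.map_neg_eq_inv, Circle.coe_inv_eq_conj, Complex.conj_conj,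
    show ℓ * j = ((ℓ.val * j.val : ℕ) : ZMod N) by
      rw [Nat.cast_mul, ZMod.natCast_zmod_val, ZMod.natCast_zmod_val],
    ZMod.toCircle_natCast]
  congr 1
  push_cast
  field_simp

/-- Term-by-term derivative of a trigonometric polynomial `∑_ℓ v(ℓ) e^{2πi ℓ t}`. [folklore] -/
theorem hasDerivAt_expSum {N : ℕ} [NeZero N] (v : ZMod N → ℂ) (x : ℝ) :
    HasDerivAt (fun t : ℝ => ∑ ℓ : ZMod N, v ℓ * Complex.exp (2 * π * I * (ℓ.val : ℕ) * t))
      (∑ ℓ : ZMod N, (v ℓ * (2 * π * I * (ℓ.val : ℕ))) *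
        Complex.exp (2 * π * I * (ℓ.val : ℕ) * x)) x := by
  have h := HasDerivAt.fun_sum (u := Finset.univ) fun ℓ _ =>
    ((hasDerivAt_cexp_const_mul_real (2 * π * I * (ℓ.val : ℕ)) x).const_mul (v ℓ))
  simpa only [mul_assoc] using h

/-! ## The test function `f̂ = ∑_ℓ v(ℓ) 𝟙_{[ℓ - 1/8, ℓ + 1/8]}` -/

/-- Distinct residues have cells `[ℓ - 1/8, ℓ + 1/8]` that do not meet. [folklore] -/
theorem not_mem_cell_of_ne {N : ℕ} [NeZero N] {ℓ ℓ' : ZMod N} (h : ℓ ≠ ℓ') {ξ : ℝ}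
    (hξ : ξ ∈ Icc ((ℓ.val : ℝ) - 1 / 8) ((ℓ.val : ℝ) + 1 / 8)) :
    ξ ∉ Icc ((ℓ'.val : ℝ) - 1 / 8) ((ℓ'.val : ℝ) + 1 / 8) := by
  intro hξ'
  have hne : ℓ.val ≠ ℓ'.val := fun e => h (ZMod.val_injective N e)
  rcases lt_or_gt_of_ne hne with hlt | hlt
  · have h5 : (ℓ.val : ℝ) + 1 ≤ ℓ'.val := by exact_mod_cast hlt
    linarith [hξ.2, hξ'.1]
  · have h5 : (ℓ'.val : ℝ) + 1 ≤ ℓ.val := by exact_mod_cast hlt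
    linarith [hξ.1, hξ'.2]

/-- Pointwise: `|f̂(ξ)|² = ∑_ℓ |v(ℓ)|² 𝟙_{[ℓ-1/8, ℓ+1/8]}(ξ)` (the cells are disjoint). [folklore] -/
theorem norm_sq_cellSum {N : ℕ} [NeZero N] (v : ZMod N → ℂ) (ξ : ℝ) :
    ‖∑ ℓ : ZMod N, (Icc ((ℓ.val : ℝ) - 1 / 8) ((ℓ.val : ℝ) + 1 / 8)).indicator (fun _ => v ℓ) ξ‖ ^ 2
      = ∑ ℓ : ZMod N,
          (Icc ((ℓ.val : ℝ) - 1 / 8) ((ℓ.val : ℝ) + 1 / 8)).indicator (fun _ => ‖v ℓ‖ ^ 2) ξ := by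
  by_cases h : ∃ ℓ₀ : ZMod N, ξ ∈ Icc ((ℓ₀.val : ℝ) - 1 / 8) ((ℓ₀.val : ℝ) + 1 / 8)
  · obtain ⟨ℓ₀, h₀⟩ := h
    rw [Finset.sum_eq_single ℓ₀, Finset.sum_eq_single ℓ₀, indicator_of_mem h₀,
      indicator_of_mem h₀]
    · exact fun ℓ _ hℓ => indicator_of_notMem (not_mem_cell_of_ne (Ne.symm hℓ) h₀) _
    · exact fun h => (h (Finset.mem_univ _)).elim
    · exact fun ℓ _ hℓ => indicator_of_notMem (not_mem_cell_of_ne (Ne.symm hℓ) h₀) _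
    · exact fun h => (h (Finset.mem_univ _)).elim
  · push Not at h
    rw [Finset.sum_eq_zero fun ℓ _ => indicator_of_notMem (h ℓ) _,
      Finset.sum_eq_zero fun ℓ _ => indicator_of_notMem (h ℓ) _, norm_zero]
    norm_num

/-- `‖f̂‖²_{L²} = (1/4) ∑_ℓ |v(ℓ)|²` for `f̂ = ∑_ℓ v(ℓ) 𝟙_{[ℓ-1/8, ℓ+1/8]}`. [folklore] -/
theorem integral_norm_sq_cellSum {N : ℕ} [NeZero N] (v : ZMod N → ℂ) :
    ∫ ξ : ℝ, ‖∑ ℓ : ZMod N,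
        (Icc ((ℓ.val : ℝ) - 1 / 8) ((ℓ.val : ℝ) + 1 / 8)).indicator (fun _ => v ℓ) ξ‖ ^ 2
      = (1 / 4) * ∑ ℓ : ZMod N, ‖v ℓ‖ ^ 2 := by
  simp_rw [norm_sq_cellSum]
  rw [integral_finsetSum _ fun ℓ _ => ?_, Finset.mul_sum]
  · refine Finset.sum_congr rfl fun ℓ _ => ?_
    rw [integral_indicator_const _ measurableSet_Icc, Real.volume_real_Icc_of_le (by linarith),
      smul_eq_mul]
    ring
  · exact (integrableOn_const (by simp [Real.volume_Icc])).integrable_indicator measurableSet_Icc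

/-- `f̂ ∈ L²`. [folklore] -/
theorem memLp_cellSum {N : ℕ} [NeZero N] (v : ZMod N → ℂ) :
    MemLp (fun ξ : ℝ => ∑ ℓ : ZMod N,
      (Icc ((ℓ.val : ℝ) - 1 / 8) ((ℓ.val : ℝ) + 1 / 8)).indicator (fun _ => v ℓ) ξ) 2 volume :=
  memLp_finsetSum _ fun ℓ _ =>
    memLp_indicator_const 2 measurableSet_Icc (v ℓ) (Or.inr (by simp [Real.volume_Icc]))

/-- `f̂ ∈ L¹`. [folklore] -/
theorem integrable_cellSum {N : ℕ} [NeZero N] (v : ZMod N → ℂ) :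
    Integrable (fun ξ : ℝ => ∑ ℓ : ZMod N,
      (Icc ((ℓ.val : ℝ) - 1 / 8) ((ℓ.val : ℝ) + 1 / 8)).indicator (fun _ => v ℓ) ξ) volume :=
  integrable_finsetSum _ fun ℓ _ =>
    (integrableOn_const (by simp [Real.volume_Icc])).integrable_indicator measurableSet_Icc

/-- If `f̂(ξ) ≠ 0` then `ξ` lies in the cell of some `ℓ` with `v(ℓ) ≠ 0`. [folklore] -/
theorem exists_of_cellSum_ne_zero {N : ℕ} [NeZero N] (v : ZMod N → ℂ) {ξ : ℝ}
    (h : ∑ ℓ : ZMod N,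
      (Icc ((ℓ.val : ℝ) - 1 / 8) ((ℓ.val : ℝ) + 1 / 8)).indicator (fun _ => v ℓ) ξ ≠ 0) :
    ∃ ℓ : ZMod N, v ℓ ≠ 0 ∧ ξ ∈ Icc ((ℓ.val : ℝ) - 1 / 8) ((ℓ.val : ℝ) + 1 / 8) := by
  obtain ⟨ℓ, -, hℓ⟩ := Finset.exists_ne_zero_of_sum_ne_zero h
  by_cases hξ : ξ ∈ Icc ((ℓ.val : ℝ) - 1 / 8) ((ℓ.val : ℝ) + 1 / 8)
  · rw [indicator_of_mem hξ] at hℓ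
    exact ⟨ℓ, hℓ, hξ⟩
  · exact (hℓ (indicator_of_notMem hξ _)).elim

/-- The inverse Fourier transform on `ℝ`, written out: `𝓕⁻ g (x) = ∫ e^{2πi ξ x} g(ξ) dξ`. [folklore] -/
theorem fourierInv_real_apply (g : ℝ → ℂ) (x : ℝ) :
    (𝓕⁻ g : ℝ → ℂ) x = ∫ ξ : ℝ, Complex.exp (2 * π * I * ξ * x) * g ξ := by
  rw [Real.fourierInv_eq']
  congr 1
  ext ξ
  rw [smul_eq_mul, RCLike.inner_apply]
  congr 1
  push_cast
  simp only [conj_trivial]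
  ring_nf

/-- **`𝓕⁻¹ f̂ = φ · P`**: the inverse Fourier transform of the test function is the trigonometric
polynomial `P(x) = ∑_ℓ v(ℓ) e^{2πiℓx}` times `φ(x) = ∫_{-1/8}^{1/8} e^{2πiηx} dη = 𝓕⁻¹𝟙_{[-1/8,1/8]}(x)`.
[cite: DyatlovJin2018, proof of Prop. 4.8] -/
theorem fourierInv_cellSum {N : ℕ} [NeZero N] (v : ZMod N → ℂ) (x : ℝ) :
    (𝓕⁻ (fun ξ : ℝ => ∑ ℓ : ZMod N,
        (Icc ((ℓ.val : ℝ) - 1 / 8) ((ℓ.val : ℝ) + 1 / 8)).indicator (fun _ => v ℓ) ξ) : ℝ → ℂ) x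
      = (∫ η in (-(1 / 8) : ℝ)..(1 / 8), Complex.exp (2 * π * I * η * x)) *
          ∑ ℓ : ZMod N, v ℓ * Complex.exp (2 * π * I * (ℓ.val : ℕ) * x) := by
  rw [fourierInv_real_apply]
  have hterm : ∀ ℓ : ZMod N, ∀ ξ : ℝ, Complex.exp (2 * π * I * ξ * x) *
      (Icc ((ℓ.val : ℝ) - 1 / 8) ((ℓ.val : ℝ) + 1 / 8)).indicator (fun _ => v ℓ) ξ =
      (Icc ((ℓ.val : ℝ) - 1 / 8) ((ℓ.val : ℝ) + 1 / 8)).indicator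
        (fun ξ => Complex.exp (2 * π * I * ξ * x) * v ℓ) ξ := by
    intro ℓ ξ
    by_cases hξ : ξ ∈ Icc ((ℓ.val : ℝ) - 1 / 8) ((ℓ.val : ℝ) + 1 / 8)
    · rw [indicator_of_mem hξ, indicator_of_mem hξ]
    · rw [indicator_of_notMem hξ, indicator_of_notMem hξ, mul_zero]
  have hint : ∀ ℓ : ZMod N, Integrable (fun ξ : ℝ =>
      (Icc ((ℓ.val : ℝ) - 1 / 8) ((ℓ.val : ℝ) + 1 / 8)).indicator
        (fun ξ => Complex.exp (2 * π * I * ξ * x) * v ℓ) ξ) volume := fun ℓ =>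
    ((Continuous.integrableOn_Icc (by fun_prop)).integrable_indicator measurableSet_Icc)
  simp_rw [Finset.mul_sum, hterm]
  rw [integral_finsetSum _ fun ℓ _ => hint ℓ]
  refine Finset.sum_congr rfl fun ℓ _ => ?_
  rw [integral_indicator measurableSet_Icc, integral_Icc_eq_integral_Ioc,
    ← intervalIntegral.integral_of_le (by linarith),
    show ((ℓ.val : ℝ) - 1 / 8) = -(1 / 8) + ℓ.val by ring,
    show ((ℓ.val : ℝ) + 1 / 8) = 1 / 8 + ℓ.val by ring,
    ← intervalIntegral.integral_comp_add_right _ (ℓ.val : ℝ)]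
  have hsplit : ∀ η : ℝ, Complex.exp (2 * π * I * ((η + (ℓ.val : ℝ) : ℝ) : ℂ) * x) * v ℓ =
      Complex.exp (2 * π * I * η * x) * (v ℓ * Complex.exp (2 * π * I * (ℓ.val : ℕ) * x)) := by
    intro η
    rw [show (2 * π * I * ((η + (ℓ.val : ℝ) : ℝ) : ℂ) * x) =
        2 * π * I * η * x + 2 * π * I * (ℓ.val : ℕ) * x by push_cast; ring, Complex.exp_add]
    ring
  simp_rw [hsplit]
  rw [intervalIntegral.integral_mul_const]

/-- The lower bound `|φ(x)| ≥ 1/8` for `|x| ≤ 1`, `φ(x) = ∫_{-1/8}^{1/8} e^{2πiηx} dη`: indeed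
`Re φ(x) = ∫ cos(2πηx) dη` and `cos θ ≥ 1/2` for `|θ| ≤ π/4 ≤ 1`. [folklore] -/
theorem norm_phi_ge {x : ℝ} (hx : x ∈ Icc (-1 : ℝ) 1) :
    (1 / 8 : ℝ) ≤ ‖∫ η in (-(1 / 8) : ℝ)..(1 / 8), Complex.exp (2 * π * I * η * x)‖ := by
  have hre : (∫ η in (-(1 / 8) : ℝ)..(1 / 8), Complex.exp (2 * π * I * η * x)).re =
      ∫ η in (-(1 / 8) : ℝ)..(1 / 8), Real.cos (2 * π * η * x) := by
    have hI : IntegrableOn (fun η : ℝ => Complex.exp (2 * π * I * η * x)) (Ioc (-(1 / 8)) (1 / 8))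
        volume := (Continuous.integrableOn_Icc (by fun_prop)).mono_set Ioc_subset_Icc_self
    have hre' := integral_re hI
    simp only [RCLike.re_to_complex] at hre'
    rw [intervalIntegral.integral_of_le (by norm_num), intervalIntegral.integral_of_le (by norm_num),
      ← hre']
    refine setIntegral_congr_fun measurableSet_Ioc fun η _ => ?_
    rw [show (2 * π * I * η * x : ℂ) = ((2 * π * η * x : ℝ) : ℂ) * I by push_cast; ring,
      Complex.exp_ofReal_mul_I_re]
  have hcos : ∀ η ∈ Icc (-(1 / 8) : ℝ) (1 / 8), (1 / 2 : ℝ) ≤ Real.cos (2 * π * η * x) := by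
    intro η hη
    have hθ : |2 * π * η * x| ≤ 1 := by
      rw [abs_mul, abs_mul, abs_mul, abs_two, abs_of_pos Real.pi_pos]
      have h1 : |η| ≤ 1 / 8 := abs_le.2 ⟨by linarith [hη.1], hη.2⟩
      have h2 : |x| ≤ 1 := abs_le.2 ⟨by linarith [hx.1], hx.2⟩
      calc 2 * π * |η| * |x| ≤ 2 * 4 * (1 / 8) * 1 := by
            gcongr
            exact Real.pi_le_four
        _ = 1 := by norm_num
    have h := Real.one_sub_sq_div_two_le_cos (x := 2 * π * η * x)
    have hsq : (2 * π * η * x) ^ 2 ≤ 1 := by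
      rw [← sq_abs]; nlinarith [abs_nonneg (2 * π * η * x)]
    linarith
  have hint : (1 / 8 : ℝ) ≤ ∫ η in (-(1 / 8) : ℝ)..(1 / 8), Real.cos (2 * π * η * x) := by
    have h := intervalIntegral.integral_mono_on (by norm_num : (-(1 / 8) : ℝ) ≤ 1 / 8)
      (by simp : IntervalIntegrable (fun _ : ℝ => (1 / 2 : ℝ)) volume (-(1 / 8)) (1 / 8))
      (Continuous.intervalIntegrable (by fun_prop) _ _) hcos
    rw [intervalIntegral.integral_const, smul_eq_mul] at h
    linarith
  calc (1 / 8 : ℝ) ≤ |(∫ η in (-(1 / 8) : ℝ)..(1 / 8), Complex.exp (2 * π * I * η * x)).re| := by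
        rw [hre]; exact hint.trans (le_abs_self _)
    _ ≤ _ := Complex.abs_re_le_norm _

/-! ## Assembly: Proposition 4.8 from Bourgain–Dyatlov, Theorem 4 -/

/-- The cells `X̃ = ⋃_{x ∈ X} [(x-1)/N, (x+1)/N]` of `X ⊆ {0,…,N-1}` lie in `[-1, 1]`. [folklore] -/
theorem fatten_subset_Icc {N : ℕ} (hN : 0 < N) {X : Finset ℕ} (hX : ∀ x ∈ X, x < N) :
    (⋃ x ∈ X, Icc (((x : ℝ) - 1) / N) (((x : ℝ) + 1) / N)) ⊆ Icc (-1 : ℝ) 1 := by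
  intro t ht
  obtain ⟨x, hx, h1, h2⟩ := mem_iUnion₂.1 ht
  have hNr : (0 : ℝ) < N := by exact_mod_cast hN
  have hN1 : (1 : ℝ) ≤ N := by exact_mod_cast hN
  have hxN : (x : ℝ) + 1 ≤ N := by exact_mod_cast hX x hx
  have hx0 : (0 : ℝ) ≤ x := Nat.cast_nonneg x
  constructor
  · refine le_trans ?_ h1
    rw [le_div_iff₀ hNr]
    nlinarith
  · refine h2.trans ?_
    rwa [div_le_one hNr]

/-- The fattened set `Ỹ = ⋃_{y ∈ Y} [y-1, y+1]` of `Y ⊆ {0,…,N-1}` lies in `[-N, N]`. [folklore] -/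
theorem fattenOne_subset_Icc {N : ℕ} (hN : 0 < N) {Y : Finset ℕ} (hY : ∀ y ∈ Y, y < N) :
    (⋃ y ∈ Y, Icc ((y : ℝ) - 1) ((y : ℝ) + 1)) ⊆ Icc (-(N : ℝ)) N := by
  intro t ht
  obtain ⟨y, hy, h1, h2⟩ := mem_iUnion₂.1 ht
  have hN1 : (1 : ℝ) ≤ N := by exact_mod_cast hN
  have hyN : (y : ℝ) + 1 ≤ N := by exact_mod_cast hY y hy
  have hy0 : (0 : ℝ) ≤ y := Nat.cast_nonneg y
  constructor <;> linarith

/-- Reindexing `{j ∈ ℤ/N : j.val ∈ X}` by `X` itself (`X ⊆ {0,…,N-1}`). [folklore] -/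
theorem sum_filter_val_mem {N : ℕ} [NeZero N] {X : Finset ℕ} (hX : ∀ x ∈ X, x < N)
    (F : ZMod N → ℝ) :
    ∑ j ∈ (Finset.univ.filter fun j : ZMod N => j.val ∈ X), F j = ∑ x ∈ X, F (x : ZMod N) := by
  have himg : (Finset.univ.filter fun j : ZMod N => j.val ∈ X) =
      X.image (fun x : ℕ => (x : ZMod N)) := by
    ext j
    simp only [Finset.mem_filter, Finset.mem_univ, true_and, Finset.mem_image]
    constructor
    · intro hj
      exact ⟨j.val, hj, ZMod.natCast_zmod_val j⟩
    · rintro ⟨x, hx, rfl⟩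
      rwa [ZMod.val_natCast_of_lt (hX x hx)]
  rw [himg, Finset.sum_image]
  intro x hx y hy hxy
  have h := congrArg ZMod.val hxy
  rwa [ZMod.val_natCast_of_lt (hX x hx), ZMod.val_natCast_of_lt (hX y hy)] at h

end DyatlovJin2018
set_option maxHeartbeats 400000 in -- buildfix (bf3-g26): 160k/180k FAIL, 200k PASS at accept time; line-neutral budget line
open DyatlovJin2018 in
/-- **Dyatlov–Jin 2018, Proposition 4.8 at a fixed exponent `δ`** (the printed proof of Prop. 4.8,
§4.4 of arXiv:1702.03619, run at one value of `δ`): if the fractal uncertainty principle of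
Bourgain–Dyatlov (Theorem 4 there = Prop. 4.7 ibid.) holds at the exponent `δ ∈ [0, 1)` for every
regularity constant `C_R' ≥ 1` (the hypothesis `hFUP`, which is `bourgainDyatlov2018_thm4`
specialised to `δ`), then the discrete fractal uncertainty principle holds at `δ` for every constant
`C_R`, with `β = β₀/2` where `β₀` is the Bourgain–Dyatlov exponent for the constant `8 max(C_R, 1)`.
[cite: DyatlovJin2018, Prop. 4.8] -/
theorem DyatlovJin2018_prop_4_8_at_of_fup_at {δ : ℝ} (hδ0 : 0 ≤ δ) (hδ1 : δ < 1)
    (hFUP : ∀ C_R' : ℝ, 1 ≤ C_R' →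
      ∃ β : ℝ, 0 < β ∧ ∃ C : ℝ, ∀ (N : ℝ), 1 ≤ N →
        ∀ (X Y : Set ℝ), X ⊆ Icc (-1) 1 → Y ⊆ Icc (-N) N →
          IsRegularSet X δ C_R' N⁻¹ 1 → IsRegularSet Y δ C_R' 1 N →
          ∀ g : ℝ → ℂ, MemLp g 2 volume → (∀ ξ, ξ ∉ Y → g ξ = 0) →
            ∫ x in X, ‖(𝓕⁻ g : ℝ → ℂ) x‖ ^ 2 ≤ (C * N ^ (-β)) ^ 2 * ∫ ξ, ‖g ξ‖ ^ 2)
    (C_R : ℝ) :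
    ∃ C β : ℝ, 0 < C ∧ 0 < β ∧
      ∀ (N : ℕ) [NeZero N] (X Y : Finset ℕ), (∀ x ∈ X, x < N) → (∀ y ∈ Y, y < N) →
        IsDiscreteRegular δ C_R N X → IsDiscreteRegular δ C_R N Y →
          ∀ u : ZMod N → ℂ, (∀ ℓ : ZMod N, ℓ.val ∉ Y → u ℓ = 0) →
            ∑ j ∈ (Finset.univ.filter fun j : ZMod N => j.val ∈ X), ‖ZMod.dft u j‖ ^ 2 ≤
              C ^ 2 * (N : ℝ) ^ (1 - 2 * β) * ∑ ℓ : ZMod N, ‖u ℓ‖ ^ 2 := by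
  -- constants from Bourgain–Dyatlov for the fattened sets (regularity constant `8 max(C_R, 1)`)
  set C' : ℝ := 8 * max C_R 1 with hC'
  have hC'1 : 1 ≤ C' := by have := le_max_right C_R 1; rw [hC']; linarith
  obtain ⟨β₀, hβ₀, C₀, hC₀⟩ := hFUP C' hC'1
  refine ⟨6 * |C₀| + 2 * π + 1, β₀ / 2, by positivity, by positivity, ?_⟩
  intro N _ X Y hXN hYN hXreg hYreg u hu
  have hN0 : N ≠ 0 := NeZero.ne N
  have hNnat : 0 < N := Nat.pos_of_ne_zero hN0
  have hNpos : (0 : ℝ) < N := by exact_mod_cast hNnat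
  have hN1 : (1 : ℝ) ≤ N := by exact_mod_cast hNnat
  set U : ℝ := ∑ ℓ : ZMod N, ‖u ℓ‖ ^ 2 with hU
  have hU0 : 0 ≤ U := Finset.sum_nonneg fun ℓ _ => by positivity
  set M : ℝ := (N : ℝ) ^ β₀ with hM
  have hM1 : 1 ≤ M := Real.one_le_rpow hN1 hβ₀.le
  have hMpos : 0 < M := by linarith
  have hrhs : (6 * |C₀| + 2 * π + 1) ^ 2 * (N : ℝ) ^ (1 - 2 * (β₀ / 2)) * U =
      (6 * |C₀| + 2 * π + 1) ^ 2 * (N / M) * U := by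
    rw [show (1 - 2 * (β₀ / 2)) = 1 - β₀ by ring, Real.rpow_sub hNpos, Real.rpow_one]
  rw [hrhs, sum_filter_val_mem hXN]
  ------------------------------------------------------------------ trivial cases
  rcases X.eq_empty_or_nonempty with hXe | hXne
  · rw [hXe, Finset.sum_empty]; positivity
  by_cases hu0 : ∀ ℓ, u ℓ = 0
  · have hdft0 : ZMod.dft u = 0 := by rw [show u = 0 from funext hu0, map_zero]
    simp only [hdft0, Pi.zero_apply, norm_zero]
    rw [Finset.sum_eq_zero fun _ _ => by norm_num]
    positivity
  push Not at hu0
  obtain ⟨ℓ₀, hℓ₀⟩ := hu0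
  have hYne : Y.Nonempty := ⟨ℓ₀.val, by by_contra h; exact hℓ₀ (hu ℓ₀ h)⟩
  have hCR1 : 1 ≤ C_R := hXreg.one_le hXne
  have hC'eq : C' = 8 * C_R := by rw [hC', max_eq_left hCR1]
  ------------------------------------------------------------------ the trigonometric polynomial
  set v : ZMod N → ℂ := fun ℓ => conj (u ℓ) with hv
  have hvn : ∀ ℓ, ‖v ℓ‖ = ‖u ℓ‖ := fun ℓ => by simp [hv]
  set P : ℝ → ℂ := fun t => ∑ ℓ : ZMod N, v ℓ * Complex.exp (2 * π * I * (ℓ.val : ℕ) * t)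
    with hP
  set P' : ℝ → ℂ := fun t => ∑ ℓ : ZMod N, (v ℓ * (2 * π * I * (ℓ.val : ℕ))) *
    Complex.exp (2 * π * I * (ℓ.val : ℕ) * t) with hP'
  have hPd : ∀ t, HasDerivAt P (P' t) t := fun t => hasDerivAt_expSum v t
  have hPc : Continuous P := by rw [hP]; fun_prop
  have hP'c : Continuous P' := by rw [hP']; fun_prop
  have hdft : ∀ x ∈ X, ‖ZMod.dft u (x : ZMod N)‖ = ‖P ((x : ℝ) / N)‖ := by
    intro x hx
    rw [← Complex.norm_conj, conj_dft_eq_expSum, ZMod.val_natCast_of_lt (hXN x hx)]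
  ------------------------------------------------------------------ the test function
  set g : ℝ → ℂ := fun ξ => ∑ ℓ : ZMod N,
    (Icc ((ℓ.val : ℝ) - 1 / 8) ((ℓ.val : ℝ) + 1 / 8)).indicator (fun _ => v ℓ) ξ with hg
  set φ : ℝ → ℂ := fun t => ∫ η in (-(1 / 8) : ℝ)..(1 / 8), Complex.exp (2 * π * I * η * t)
    with hφ
  have hFg : ∀ t, (𝓕⁻ g : ℝ → ℂ) t = φ t * P t := fun t => fourierInv_cellSum v t
  have hgi : Integrable g volume := integrable_cellSum v
  have hcontF : Continuous (𝓕⁻ g : ℝ → ℂ) :=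
    VectorFourier.fourierIntegral_continuous (L := -innerₗ ℝ) Real.continuous_fourierChar
      (by exact continuous_inner.neg) hgi
  set Xt : Set ℝ := ⋃ x ∈ X, Icc (((x : ℝ) - 1) / N) (((x : ℝ) + 1) / N) with hXt
  set Yt : Set ℝ := ⋃ y ∈ Y, Icc ((y : ℝ) - 1) ((y : ℝ) + 1) with hYt
  have hXt1 : Xt ⊆ Icc (-1 : ℝ) 1 := fatten_subset_Icc hNnat hXN
  have hregX : IsRegularSet Xt δ C' (N : ℝ)⁻¹ 1 := by
    have h := isRegularSet_fatten hδ0 hδ1.le hXreg hXne hNpos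
    rw [one_div, div_self hNpos.ne'] at h
    rw [hC'eq]
    exact h
  have hregY : IsRegularSet Yt δ C' 1 N := by
    have h := isRegularSet_fatten hδ0 hδ1.le hYreg hYne one_pos
    simp only [div_one] at h
    rw [hC'eq]
    exact h
  have hsupp : ∀ ξ, ξ ∉ Yt → g ξ = 0 := by
    intro ξ hξ
    by_contra hne
    obtain ⟨ℓ, hℓ, hmem⟩ := exists_of_cellSum_ne_zero v hne
    have hℓY : ℓ.val ∈ Y := by
      by_contra h
      exact hℓ (by simp [hv, hu ℓ h])
    exact hξ (mem_iUnion₂.2 ⟨ℓ.val, hℓY, by linarith [hmem.1], by linarith [hmem.2]⟩)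
  have hBDapp := hC₀ N hN1 Xt Yt hXt1 (fattenOne_subset_Icc hNnat hYN) hregX hregY g
    (memLp_cellSum v) hsupp
  have hgnorm : ∫ ξ, ‖g ξ‖ ^ 2 = (1 / 4) * U := by
    rw [hg, integral_norm_sq_cellSum, hU]
    simp_rw [hvn]
  rw [hgnorm] at hBDapp
  ------------------------------------------------------------------ step A: cells vs the BD bound
  set f2 : ℝ → ℝ := fun t => ‖(𝓕⁻ g : ℝ → ℂ) t‖ ^ 2 with hf2
  have hf2c : Continuous f2 := (hcontF.norm).pow 2
  have hf2nn : ∀ t, 0 ≤ f2 t := fun t => by positivity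
  have hle : ∀ x : ℕ, ((x : ℝ) - 1 / 2) / N ≤ ((x : ℝ) + 1 / 2) / N := fun x =>
    div_le_div_of_nonneg_right (by linarith) hNpos.le
  have hcellI : ∀ x ∈ X, Icc (((x : ℝ) - 1 / 2) / N) (((x : ℝ) + 1 / 2) / N) ⊆ Icc (-1 : ℝ) 1 := by
    intro x hx t ht
    have hxN : (x : ℝ) + 1 ≤ N := by exact_mod_cast hXN x hx
    have hx0 : (0 : ℝ) ≤ x := Nat.cast_nonneg x
    constructor
    · refine le_trans ?_ ht.1
      rw [le_div_iff₀ hNpos]; nlinarith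
    · refine ht.2.trans ?_
      rw [div_le_one hNpos]; linarith
  have hPf : ∀ t ∈ Icc (-1 : ℝ) 1, ‖P t‖ ^ 2 ≤ 64 * f2 t := by
    intro t ht
    have h8 : (1 / 8 : ℝ) ≤ ‖φ t‖ := norm_phi_ge ht
    have hf : f2 t = ‖φ t‖ ^ 2 * ‖P t‖ ^ 2 := by
      simp only [hf2, hFg t, norm_mul, mul_pow]
    rw [hf]
    have h64 : 1 ≤ 64 * ‖φ t‖ ^ 2 := by nlinarith [h8, norm_nonneg (φ t)]
    have h' := mul_le_mul_of_nonneg_right h64 (sq_nonneg ‖P t‖)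
    linarith
  have hcells : ∑ x ∈ X, ∫ t in (((x : ℝ) - 1 / 2) / N)..(((x : ℝ) + 1 / 2) / N), f2 t
      ≤ ∫ t in Xt, f2 t := by
    have hdisj : Set.PairwiseDisjoint (↑X : Set ℕ)
        (fun x : ℕ => Ioc (((x : ℝ) - 1 / 2) / N) (((x : ℝ) + 1 / 2) / N)) := by
      intro x _ y _ hxy
      refine Set.disjoint_left.2 fun t htx hty => ?_
      have h2 := (div_lt_div_iff_of_pos_right hNpos).1 (hty.1.trans_le htx.2)
      have h3 := (div_lt_div_iff_of_pos_right hNpos).1 (htx.1.trans_le hty.2)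
      rcases lt_or_gt_of_ne hxy with hlt | hlt
      · have h5 : (x : ℝ) + 1 ≤ y := by exact_mod_cast hlt
        linarith
      · have h5 : (y : ℝ) + 1 ≤ x := by exact_mod_cast hlt
        linarith
    have hUsub : (⋃ x ∈ X, Ioc (((x : ℝ) - 1 / 2) / N) (((x : ℝ) + 1 / 2) / N)) ⊆ Xt := by
      intro t ht
      obtain ⟨x, hx, h1, h2⟩ := mem_iUnion₂.1 ht
      refine mem_iUnion₂.2 ⟨x, hx, ?_, ?_⟩
      · exact (div_le_div_of_nonneg_right (by linarith) hNpos.le).trans h1.le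
      · exact h2.trans (div_le_div_of_nonneg_right (by linarith) hNpos.le)
    calc ∑ x ∈ X, ∫ t in (((x : ℝ) - 1 / 2) / N)..(((x : ℝ) + 1 / 2) / N), f2 t
        = ∑ x ∈ X, ∫ t in Ioc (((x : ℝ) - 1 / 2) / N) (((x : ℝ) + 1 / 2) / N), f2 t :=
          Finset.sum_congr rfl fun x _ => intervalIntegral.integral_of_le (hle x)
      _ = ∫ t in ⋃ x ∈ X, Ioc (((x : ℝ) - 1 / 2) / N) (((x : ℝ) + 1 / 2) / N), f2 t := by
          rw [integral_biUnion_finset _ (fun x _ => measurableSet_Ioc) hdisj fun x _ =>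
            (hf2c.integrableOn_Icc).mono_set Ioc_subset_Icc_self]
      _ ≤ ∫ t in Xt, f2 t :=
          setIntegral_mono_set ((hf2c.integrableOn_Icc).mono_set hXt1)
            (Filter.Eventually.of_forall fun t => hf2nn t) hUsub.eventuallyLE
  have hA : ∑ x ∈ X, ∫ t in (((x : ℝ) - 1 / 2) / N)..(((x : ℝ) + 1 / 2) / N), ‖P t‖ ^ 2 ≤
      16 * C₀ ^ 2 / M ^ 2 * U := by
    calc ∑ x ∈ X, ∫ t in (((x : ℝ) - 1 / 2) / N)..(((x : ℝ) + 1 / 2) / N), ‖P t‖ ^ 2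
        ≤ ∑ x ∈ X, ∫ t in (((x : ℝ) - 1 / 2) / N)..(((x : ℝ) + 1 / 2) / N), 64 * f2 t := by
          refine Finset.sum_le_sum fun x hx => intervalIntegral.integral_mono_on (hle x)
            (Continuous.intervalIntegrable (by fun_prop) _ _)
            (Continuous.intervalIntegrable (by fun_prop) _ _) fun t ht => hPf t (hcellI x hx ht)
      _ = 64 * ∑ x ∈ X, ∫ t in (((x : ℝ) - 1 / 2) / N)..(((x : ℝ) + 1 / 2) / N), f2 t := by
          rw [Finset.mul_sum]
          refine Finset.sum_congr rfl fun x _ => intervalIntegral.integral_const_mul _ _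
      _ ≤ 64 * ∫ t in Xt, f2 t := by gcongr
      _ ≤ 64 * ((C₀ * (N : ℝ) ^ (-β₀)) ^ 2 * ((1 / 4) * U)) := by gcongr
      _ = 16 * C₀ ^ 2 / M ^ 2 * U := by
          rw [Real.rpow_neg hNpos.le, ← hM]
          field_simp
          ring
  ------------------------------------------------------------------ step B: Parseval for P'
  have hB : ∑ x ∈ X, ∫ t in (((x : ℝ) - 1 / 2) / N)..(((x : ℝ) + 1 / 2) / N), ‖P' t‖ ^ 2 ≤
      (2 * π * N) ^ 2 * U := by
    calc ∑ x ∈ X, ∫ t in (((x : ℝ) - 1 / 2) / N)..(((x : ℝ) + 1 / 2) / N), ‖P' t‖ ^ 2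
        ≤ ∫ t in ((-(1 / 2) : ℝ) / N)..((-(1 / 2) : ℝ) / N + 1), ‖P' t‖ ^ 2 :=
          sum_cellIntegral_le hNnat hXN ((hP'c.norm).pow 2) fun t => by positivity
      _ = ∑ ℓ : ZMod N, ‖v ℓ * (2 * π * I * (ℓ.val : ℕ))‖ ^ 2 :=
          intervalIntegral_norm_sq_expSum Finset.univ (fun ℓ : ZMod N => ℓ.val)
            (fun a _ b _ h => ZMod.val_injective N h) _ _
      _ ≤ ∑ ℓ : ZMod N, (2 * π * N) ^ 2 * ‖u ℓ‖ ^ 2 := by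
          refine Finset.sum_le_sum fun ℓ _ => ?_
          have hval : ((ℓ.val : ℕ) : ℝ) ≤ N := by exact_mod_cast (ZMod.val_lt ℓ).le
          have hn : ‖(2 * π * I * (ℓ.val : ℕ) : ℂ)‖ = 2 * π * (ℓ.val : ℕ) := by
            rw [norm_mul, norm_mul, norm_mul, Complex.norm_I, Complex.norm_real, Complex.norm_natCast,
              Complex.norm_two, Real.norm_of_nonneg Real.pi_pos.le, mul_one]
          rw [norm_mul, mul_pow, hvn, hn]
          have : (2 * π * (ℓ.val : ℕ)) ^ 2 ≤ (2 * π * N) ^ 2 := by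
            gcongr
          nlinarith [sq_nonneg ‖u ℓ‖]
      _ = (2 * π * N) ^ 2 * U := by rw [hU, Finset.mul_sum]
  ------------------------------------------------------------------ step C: local Sobolev, summed
  have hlam : 0 < (N : ℝ) * M := by positivity
  have hC : ∀ x ∈ X, ‖P ((x : ℝ) / N)‖ ^ 2 ≤
      ((N : ℝ) + N * M) * (∫ t in (((x : ℝ) - 1 / 2) / N)..(((x : ℝ) + 1 / 2) / N), ‖P t‖ ^ 2) +
        ((N : ℝ) * M)⁻¹ * ∫ t in (((x : ℝ) - 1 / 2) / N)..(((x : ℝ) + 1 / 2) / N), ‖P' t‖ ^ 2 := by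
    intro x hx
    have ht₀ : (x : ℝ) / N ∈ Icc (((x : ℝ) - 1 / 2) / N) (((x : ℝ) + 1 / 2) / N) :=
      ⟨div_le_div_of_nonneg_right (by linarith) hNpos.le,
        div_le_div_of_nonneg_right (by linarith) hNpos.le⟩
    have h := norm_sq_le_intervalIntegral_of_hasDerivAt hPd hP'c (hle x) ht₀ hlam
    have hba : ((x : ℝ) + 1 / 2) / N - ((x : ℝ) - 1 / 2) / N = 1 / N := by
      field_simp; ring
    rw [hba] at h
    set Ax := ∫ t in (((x : ℝ) - 1 / 2) / N)..(((x : ℝ) + 1 / 2) / N), ‖P t‖ ^ 2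
    set Bx := ∫ t in (((x : ℝ) - 1 / 2) / N)..(((x : ℝ) + 1 / 2) / N), ‖P' t‖ ^ 2
    calc ‖P ((x : ℝ) / N)‖ ^ 2 = N * (1 / N * ‖P ((x : ℝ) / N)‖ ^ 2) := by field_simp
      _ ≤ N * (Ax + 1 / N * ((N : ℝ) * M * Ax + ((N : ℝ) * M)⁻¹ * Bx)) := by gcongr
      _ = ((N : ℝ) + N * M) * Ax + ((N : ℝ) * M)⁻¹ * Bx := by field_simp; ring
  have hS : ∑ x ∈ X, ‖P ((x : ℝ) / N)‖ ^ 2 ≤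
      ((N : ℝ) + N * M) * (16 * C₀ ^ 2 / M ^ 2 * U) + ((N : ℝ) * M)⁻¹ * ((2 * π * N) ^ 2 * U) := by
    calc ∑ x ∈ X, ‖P ((x : ℝ) / N)‖ ^ 2
        ≤ ∑ x ∈ X, (((N : ℝ) + N * M) *
              (∫ t in (((x : ℝ) - 1 / 2) / N)..(((x : ℝ) + 1 / 2) / N), ‖P t‖ ^ 2) +
            ((N : ℝ) * M)⁻¹ *
              ∫ t in (((x : ℝ) - 1 / 2) / N)..(((x : ℝ) + 1 / 2) / N), ‖P' t‖ ^ 2) :=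
          Finset.sum_le_sum hC
      _ = ((N : ℝ) + N * M) *
              ∑ x ∈ X, (∫ t in (((x : ℝ) - 1 / 2) / N)..(((x : ℝ) + 1 / 2) / N), ‖P t‖ ^ 2) +
            ((N : ℝ) * M)⁻¹ *
              ∑ x ∈ X, ∫ t in (((x : ℝ) - 1 / 2) / N)..(((x : ℝ) + 1 / 2) / N), ‖P' t‖ ^ 2 := by
          rw [Finset.sum_add_distrib, Finset.mul_sum, Finset.mul_sum]
      _ ≤ ((N : ℝ) + N * M) * (16 * C₀ ^ 2 / M ^ 2 * U) +
            ((N : ℝ) * M)⁻¹ * ((2 * π * N) ^ 2 * U) := by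
          gcongr
  ------------------------------------------------------------------ step D: arithmetic
  have h1 : ((N : ℝ) + N * M) * (16 * C₀ ^ 2 / M ^ 2 * U) ≤ 32 * C₀ ^ 2 * (N / M) * U := by
    rw [← sub_nonneg]
    have : 32 * C₀ ^ 2 * (N / M) * U - ((N : ℝ) + N * M) * (16 * C₀ ^ 2 / M ^ 2 * U) =
        16 * C₀ ^ 2 * N * U * (M - 1) / M ^ 2 := by
      field_simp
      ring
    rw [this]
    apply div_nonneg _ (by positivity)
    have hM' : 0 ≤ M - 1 := by linarith
    exact mul_nonneg (by positivity) hM'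
  have h2 : ((N : ℝ) * M)⁻¹ * ((2 * π * N) ^ 2 * U) = 4 * π ^ 2 * (N / M) * U := by
    field_simp
    ring
  have h3 : 32 * C₀ ^ 2 + 4 * π ^ 2 ≤ (6 * |C₀| + 2 * π + 1) ^ 2 := by
    have ha : 0 ≤ |C₀| := abs_nonneg C₀
    have hp : 0 ≤ π := Real.pi_pos.le
    have hap : 0 ≤ π * |C₀| := mul_nonneg hp ha
    have hexp : (6 * |C₀| + 2 * π + 1) ^ 2 =
        32 * C₀ ^ 2 + 4 * π ^ 2 + (4 * |C₀| ^ 2 + 24 * (π * |C₀|) + 12 * |C₀| + 4 * π + 1) := by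
      rw [← sq_abs C₀]; ring
    rw [hexp]
    linarith [sq_nonneg |C₀|]
  have hNM : 0 ≤ (N : ℝ) / M * U := by positivity
  calc ∑ x ∈ X, ‖ZMod.dft u (x : ZMod N)‖ ^ 2 = ∑ x ∈ X, ‖P ((x : ℝ) / N)‖ ^ 2 :=
        Finset.sum_congr rfl fun x hx => by rw [hdft x hx]
    _ ≤ ((N : ℝ) + N * M) * (16 * C₀ ^ 2 / M ^ 2 * U) +
          ((N : ℝ) * M)⁻¹ * ((2 * π * N) ^ 2 * U) := hS
    _ ≤ 32 * C₀ ^ 2 * (N / M) * U + 4 * π ^ 2 * (N / M) * U := by rw [h2]; linarith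
    _ = (32 * C₀ ^ 2 + 4 * π ^ 2) * ((N : ℝ) / M * U) := by ring
    _ ≤ (6 * |C₀| + 2 * π + 1) ^ 2 * ((N : ℝ) / M * U) := by gcongr
    _ = (6 * |C₀| + 2 * π + 1) ^ 2 * (N / M) * U := by ring

/-- **Dyatlov–Jin 2018, Proposition 4.8 from Bourgain–Dyatlov 2018, Theorem 4** (the printed proof
of Prop. 4.8, §4.4 of arXiv:1702.03619): the fractal uncertainty principle for `δ`-regular sets
on `ℝ` (`bourgainDyatlov2018_thm4`, the paper's Prop. 4.7) implies the discrete fractal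
uncertainty principle `DyatlovJin2018_prop_4_8` with `β = β₀/2`.
[cite: DyatlovJin2018, Prop. 4.8] -/
theorem DyatlovJin2018_prop_4_8_of_bourgainDyatlov2018_thm4 (hBD : bourgainDyatlov2018_thm4) :
    DyatlovJin2018_prop_4_8 := fun δ C_R hδ0 hδ1 =>
  DyatlovJin2018_prop_4_8_at_of_fup_at hδ0 hδ1 (fun C' hC' => hBD δ C' hδ0 hδ1 hC') C_R

namespace DyatlovJin2018

/-- **Counting bound** for a discretely regular set: `#X ≤ C_R N^δ` for `X ⊆ {0, …, N-1}`
`δ`-regular with constant `C_R` (the upper regularity bound on the interval `[0, N]`, `N ≥ 1`).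
[cite: DyatlovJin2018, Def. 4.2] -/
theorem card_le_of_isDiscreteRegular {δ C_R : ℝ} {N : ℕ} {X : Finset ℕ} (hN : (1 : ℝ) ≤ N)
    (hX : ∀ x ∈ X, x < N) (hreg : IsDiscreteRegular δ C_R N X) :
    (X.card : ℝ) ≤ C_R * (N : ℝ) ^ δ := by
  have h := hreg.1 0 N hN
  rw [zero_add] at h
  have hc : countInIcc X 0 N = X.card := by
    unfold countInIcc
    rw [Finset.filter_true_of_mem]
    intro x hx
    exact ⟨Nat.cast_nonneg x, by exact_mod_cast (hX x hx).le⟩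
  rwa [hc] at h

/-- **Pointwise bound** for the unnormalised discrete Fourier transform of a vector supported in
`Y`: `|𝓕 u(k)|² ≤ #Y · ∑_ℓ |u ℓ|²` (triangle inequality and Cauchy–Schwarz; with the unitary
`𝓕_N = N^{-1/2} 𝓕` this is `|𝓕_N u(k)|² ≤ N⁻¹ #Y ‖u‖²`). [folklore] -/
theorem norm_dft_sq_le_card_mul {N : ℕ} [NeZero N] {Y : Finset ℕ} (hY : ∀ y ∈ Y, y < N)
    (u : ZMod N → ℂ) (hu : ∀ ℓ : ZMod N, ℓ.val ∉ Y → u ℓ = 0) (k : ZMod N) :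
    ‖ZMod.dft u k‖ ^ 2 ≤ (Y.card : ℝ) * ∑ ℓ : ZMod N, ‖u ℓ‖ ^ 2 := by
  classical
  set Y' : Finset (ZMod N) := Finset.univ.filter fun ℓ : ZMod N => ℓ.val ∈ Y with hY'
  -- triangle inequality: `|𝓕 u(k)| ≤ ∑_ℓ |u ℓ| = ∑_{ℓ ∈ Y'} 1 · |u ℓ|`
  have htri : ‖ZMod.dft u k‖ ≤ ∑ ℓ ∈ Y', 1 * ‖u ℓ‖ := by
    rw [ZMod.dft_apply]
    refine (norm_sum_le _ _).trans (le_of_eq ?_)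
    rw [← Finset.sum_subset (Finset.subset_univ Y')]
    · refine Finset.sum_congr rfl fun ℓ _ => ?_
      rw [norm_smul, ZMod.stdAddChar_apply, Circle.norm_coe, one_mul]
    · intro ℓ _ hℓ
      have : u ℓ = 0 := hu ℓ (by simpa [hY'] using hℓ)
      simp [this]
  have hcard : ((Y'.card : ℕ) : ℝ) = Y.card := by
    have h := sum_filter_val_mem hY (fun _ : ZMod N => (1 : ℝ))
    simp only [Finset.sum_const, nsmul_eq_mul, mul_one] at h
    rw [hY']
    exact h
  have hCS : (∑ ℓ ∈ Y', 1 * ‖u ℓ‖) ^ 2 ≤ (∑ ℓ ∈ Y', (1 : ℝ) ^ 2) * ∑ ℓ ∈ Y', ‖u ℓ‖ ^ 2 :=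
    Finset.sum_mul_sq_le_sq_mul_sq Y' (fun _ => (1 : ℝ)) (fun ℓ => ‖u ℓ‖)
  have hsub : ∑ ℓ ∈ Y', ‖u ℓ‖ ^ 2 ≤ ∑ ℓ : ZMod N, ‖u ℓ‖ ^ 2 :=
    Finset.sum_le_sum_of_subset_of_nonneg (Finset.subset_univ Y') fun _ _ _ => by positivity
  have h0 : 0 ≤ ‖ZMod.dft u k‖ := norm_nonneg _
  calc ‖ZMod.dft u k‖ ^ 2 ≤ (∑ ℓ ∈ Y', 1 * ‖u ℓ‖) ^ 2 := by gcongr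
    _ ≤ (∑ ℓ ∈ Y', (1 : ℝ) ^ 2) * ∑ ℓ ∈ Y', ‖u ℓ‖ ^ 2 := hCS
    _ = (Y.card : ℝ) * ∑ ℓ ∈ Y', ‖u ℓ‖ ^ 2 := by
        rw [← hcard]; simp
    _ ≤ (Y.card : ℝ) * ∑ ℓ : ZMod N, ‖u ℓ‖ ^ 2 := by gcongr

end DyatlovJin2018

open DyatlovJin2018 in
/-- **Dyatlov–Jin 2018, Proposition 4.8 in the regime `0 ≤ δ < 1/2`, unconditionally**, with the
volume-bound exponent `β = 1/2 - δ` and `C = max(C_R, 1)`: "Using the Lebesgue volume bound … and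
Hölder's inequality, it is easy to obtain (1.2) with `β = max(0, 1/2 - δ)`" (§1, p. 2 ibid.; the same
dispatch opens Bourgain–Dyatlov 2018, §3.4). In `ℤ_N`: `#X, #Y ≤ C_R N^δ`
(`card_le_of_isDiscreteRegular`) and `|𝓕 u(j)|² ≤ #Y ‖u‖²` (`norm_dft_sq_le_card_mul`) give
`∑_{j ∈ X} |𝓕 u(j)|² ≤ #X #Y ‖u‖² ≤ C_R² N^{2δ} ‖u‖² = C_R² N^{1 - 2(1/2 - δ)} ‖u‖²`. Same quantifier
shape as `DyatlovJin2018_prop_4_8`, with `δ < 1` strengthened to `δ < 1/2`; the complementary regime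
`1/2 ≤ δ < 1` is `DyatlovJin2018_prop_4_8_at_of_fup_at` fed with Bourgain–Dyatlov's Theorem 4.
[cite: DyatlovJin2018, Prop. 4.8 and §1 p. 2] -/
theorem DyatlovJin2018_prop_4_8_of_lt_half :
    ∀ δ C_R : ℝ, 0 ≤ δ → δ < 1 / 2 →
    ∃ C β : ℝ, 0 < C ∧ 0 < β ∧
      ∀ (N : ℕ) [NeZero N] (X Y : Finset ℕ), (∀ x ∈ X, x < N) → (∀ y ∈ Y, y < N) →
        IsDiscreteRegular δ C_R N X → IsDiscreteRegular δ C_R N Y →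
          ∀ u : ZMod N → ℂ, (∀ ℓ : ZMod N, ℓ.val ∉ Y → u ℓ = 0) →
            ∑ j ∈ (Finset.univ.filter fun j : ZMod N => j.val ∈ X), ‖ZMod.dft u j‖ ^ 2 ≤
              C ^ 2 * (N : ℝ) ^ (1 - 2 * β) * ∑ ℓ : ZMod N, ‖u ℓ‖ ^ 2 := by
  intro δ C_R hδ0 hδh
  refine ⟨max C_R 1, 1 / 2 - δ, by positivity, by linarith, ?_⟩
  intro N _ X Y hXN hYN hXreg hYreg u hu
  have hNnat : 0 < N := Nat.pos_of_ne_zero (NeZero.ne N)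
  have hNpos : (0 : ℝ) < N := by exact_mod_cast hNnat
  have hN1 : (1 : ℝ) ≤ N := by exact_mod_cast hNnat
  set U : ℝ := ∑ ℓ : ZMod N, ‖u ℓ‖ ^ 2 with hU
  have hU0 : 0 ≤ U := Finset.sum_nonneg fun ℓ _ => by positivity
  have hexp : (N : ℝ) ^ (1 - 2 * (1 / 2 - δ)) = (N : ℝ) ^ δ * (N : ℝ) ^ δ := by
    rw [show (1 - 2 * (1 / 2 - δ)) = δ + δ by ring, Real.rpow_add hNpos]
  rw [hexp]
  rcases X.eq_empty_or_nonempty with hXe | hXne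
  · have hfe : (Finset.univ.filter fun j : ZMod N => j.val ∈ X) = ∅ := by
      rw [hXe]; simp
    rw [hfe, Finset.sum_empty]
    positivity
  have hCR1 : 1 ≤ C_R := hXreg.one_le hXne
  have hmax : max C_R 1 = C_R := max_eq_left hCR1
  have hXc : (X.card : ℝ) ≤ C_R * (N : ℝ) ^ δ := card_le_of_isDiscreteRegular hN1 hXN hXreg
  have hYc : (Y.card : ℝ) ≤ C_R * (N : ℝ) ^ δ := card_le_of_isDiscreteRegular hN1 hYN hYreg
  have hpt : ∀ j ∈ (Finset.univ.filter fun j : ZMod N => j.val ∈ X),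
      ‖ZMod.dft u j‖ ^ 2 ≤ (Y.card : ℝ) * U := fun j _ => norm_dft_sq_le_card_mul hYN u hu j
  have hXcard : ((Finset.univ.filter fun j : ZMod N => j.val ∈ X).card : ℝ) = X.card := by
    have h := sum_filter_val_mem hXN (fun _ : ZMod N => (1 : ℝ))
    simp only [Finset.sum_const, nsmul_eq_mul, mul_one] at h
    exact h
  calc ∑ j ∈ (Finset.univ.filter fun j : ZMod N => j.val ∈ X), ‖ZMod.dft u j‖ ^ 2
      ≤ ∑ j ∈ (Finset.univ.filter fun j : ZMod N => j.val ∈ X), (Y.card : ℝ) * U :=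
        Finset.sum_le_sum hpt
    _ = (X.card : ℝ) * ((Y.card : ℝ) * U) := by
        rw [Finset.sum_const, nsmul_eq_mul, hXcard]
    _ ≤ (C_R * (N : ℝ) ^ δ) * ((C_R * (N : ℝ) ^ δ) * U) := by gcongr
    _ = (max C_R 1) ^ 2 * ((N : ℝ) ^ δ * (N : ℝ) ^ δ) * U := by rw [hmax]; ring

end Literature.Analysis.Fourier
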